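import Summits.QuantumAdvantage.QuantumAdvantage.Theorems.CubicForrelationNearExactIsExactTwelveTypeO935

/-!
# Crux `CubicForrelation.NearExactIsExact` (stmt-QuantumAdvantage-14043) — n = 12, type O: a base set of size `≡ 8 (mod 16)` costs an excess of at
  least `256` (the `w = 904 / 920 / 936 / 952` lemma, uniform in the budget)

Certificate seat `b2b-cforr-cert` (gen 18).  HONEST FRAMING: a kernel-checked lemma (standard axioms) about cubic Boolean pairs on 12 bits, for the
type-O branch of the rungs below `935/1024`; NO new value of `θ₁₂`.  NOT summit progress.
`to18_typeO_w8_budget`: `W_g = 16u`, all `u` odd, base set `E = {d₁ = d₂}` with `#E = 16q + 8`.  Then `2¹⁷(1 − Φ) ≥ 4096 + 8·#E + 256`, i.e. the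
excess `Σ X` is at least `256`: by `to18_char_sum_mod16` the character sums of `E` are `≡ #E ≡ 8 (mod 16)`, Walsh inversion gives
`Σ_x v(x)(−1)^{x·y} = 8K(y) ± 4` for every `y`, so every squared transform value is `≥ 16`, Parseval for `v` gives `Σ v² ≥ 16`, and `X ≥ 16v²`
pointwise.  (For `#E = 904`: `Φ ≤ 1 − 11584/2¹⁷ < 934/1024`; for `920`: `< 933/1024`.)  The proof is the `#E = 904` branch of `to18_typeO_ge935_rigid`
with a symbolic `q`.  References: Ax (1964) / McEliece (1972); MacWilliams–Sloane (1977) Ch. 15.  Axioms: the standard three.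
-/

set_option linter.dupNamespace false -- D-0017: single-problem summit ⇒ `QuantumAdvantage.QuantumAdvantage` by design

noncomputable section

namespace Summit.QuantumAdvantage.QuantumAdvantage.Theorems.CubicForrelation.NearExactIsExact

open Finset
open Literature.Computability.QuantumComplexity
open Literature.Computability.QuantumComplexity.BuzetChailloux (bxor zeroVec bxor_bxor_cancel_left bxor_zeroVec zeroVec_bxor bxor_comm
  bxor_self twist_zeroVec_right twist_bxor_right signOf_sq)
open Literature.Computability.QuantumComplexity.DerivativeWalsh (W sum_W_sq)
open Literature.Computability.QuantumComplexity.Simon (twist_eq_one_or)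
open Summit.QuantumAdvantage.QuantumAdvantage.Theorems.NearExactIsExact.Negative (TypeOTwelve.typeO_of_exists_odd)

/-- **A type-O base set of size `≡ 8 (mod 16)` forces excess `≥ 256`**: `2¹⁷(1 − Φ) ≥ 4352 + 8·#E`.  See the module docstring.  NOT summit
progress. [this work] -/
theorem to18_typeO_w8_budget (f g : (Fin (6 + 6) → Bool) → Bool) (hf : IsDegLeFun 3 f) (hg : IsDegLeFun 3 g)
    (u : (Fin (6 + 6) → Bool) → ℤ) (hu : ∀ x, W (fun y => signOf (g y)) x = (2 : ℝ) ^ 4 * (u x : ℝ))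
    (hodd : ∃ x, Odd (u x)) (q : ℕ) (hEq : #(univ.filter fun x : Fin (6 + 6) → Bool => (Odd (u x / 2) ↔ Odd (u x / 2 / 2))) = 16 * q + 8) :
    (4352 : ℝ) + 8 * #(univ.filter fun x : Fin (6 + 6) → Bool => (Odd (u x / 2) ↔ Odd (u x / 2 / 2))) ≤
      2 ^ 17 * (1 - forrelation f g) := by
  classical
  have hall : ∀ x, Odd (u x) := TypeOTwelve.typeO_of_exists_odd g u hg hu hodd
  have hu' : ∀ x, W (fun y => signOf (g y)) x = (2 : ℝ) ^ (2 * 2) * (u x : ℝ) := fun x => (hu x).trans (by norm_num)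
  have hd1 : IsDegLeFun 1 (fun x => decide (Odd (u x / 2))) := z2_digitOne 2 g u hg hu' hall
  have hd2 : IsDegLeFun 3 (fun x => decide (Odd (u x / 2 / 2))) := z2_digitTwo 2 g u hg hu' hall
  set E := univ.filter (fun x : Fin (6 + 6) → Bool => (Odd (u x / 2) ↔ Odd (u x / 2 / 2))) with hEdef
  have hdegE : IsDegLeFun (2 + 1) (fun x => (decide (Odd (u x / 2)) ^^ decide (Odd (u x / 2 / 2))) ^^ true) :=
    tb_isDegLeFun_xor_const (bb_isDegLeFun_bxor (hd1.mono (by norm_num)) hd2) true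
  have hsetE : (univ.filter fun x : Fin (6 + 6) → Bool =>
      ((decide (Odd (u x / 2)) ^^ decide (Odd (u x / 2 / 2))) ^^ true) = true) = E := by
    rw [hEdef]
    apply filter_congr
    intro x _
    by_cases h1 : Odd (u x / 2) <;> by_cases h2 : Odd (u x / 2 / 2) <;> simp [h1, h2]
  have hsumE : (∑ x, (if (Odd (u x / 2) ↔ Odd (u x / 2 / 2)) then 1 else 0 : ℤ)) = #E := by rw [sum_boole]
  have hbud := tw12_budget f g u hu
  -- base pattern and wild function
  choose v hv using fun x => to12_pt_mod8 (u x) (sZ (f x)) (hall x) (tp_sZ_cases (f x))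
  set τ₀ : (Fin (6 + 6) → Bool) → ℤ := fun x =>
    sZ (decide (Odd (u x / 2))) * (1 - 4 * (if (Odd (u x / 2) ↔ Odd (u x / 2 / 2)) then 1 else 0)) with hτ₀def
  have hvx : ∀ x, u x - 4 * sZ (f x) = τ₀ x + 8 * v x := fun x => hv x
  have hτ₀val : ∀ x, τ₀ x = 1 ∨ τ₀ x = -1 ∨ τ₀ x = 3 ∨ τ₀ x = -3 := by
    intro x
    simp only [τ₀]
    rcases tp_sZ_cases (decide (Odd (u x / 2))) with h | h <;> rw [h] <;> split_ifs <;> norm_num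
  have hτ₀sq : ∀ x, τ₀ x ^ 2 = 1 + 8 * (if (Odd (u x / 2) ↔ Odd (u x / 2 / 2)) then 1 else 0 : ℤ) := by
    intro x
    simp only [τ₀]
    rcases tp_sZ_cases (decide (Odd (u x / 2))) with h | h <;> rw [h] <;> split_ifs <;> norm_num
  have hsumτ₀ : ∑ x, τ₀ x ^ 2 = 4096 + 8 * #E := by
    rw [sum_congr rfl fun x _ => hτ₀sq x, sum_add_distrib, ← mul_sum, hsumE, sum_const, card_univ, Fintype.card_fun,
      Fintype.card_bool, Fintype.card_fin]
    norm_num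
  set X : (Fin (6 + 6) → Bool) → ℤ := fun x => (τ₀ x + 8 * v x) ^ 2 - τ₀ x ^ 2 with hXdef
  have hXv : ∀ x, 16 * v x ^ 2 ≤ X x := by
    intro x
    have hid : X x - 16 * v x ^ 2 = 16 * (v x * (3 * v x + τ₀ x)) := by simp only [X]; ring
    have hτ3 : -3 ≤ τ₀ x ∧ τ₀ x ≤ 3 := by rcases hτ₀val x with h | h | h | h <;> rw [h] <;> norm_num
    have hprod : 0 ≤ v x * (3 * v x + τ₀ x) := by
      rcases lt_trichotomy (v x) 0 with h0 | h0 | h0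
      · exact mul_nonneg_of_nonpos_of_nonpos h0.le (by linarith)
      · rw [h0]; simp
      · exact mul_nonneg h0.le (by linarith)
    linarith
  have hTdec : (∑ x, (u x - 4 * sZ (f x)) ^ 2 : ℤ) = ∑ x, τ₀ x ^ 2 + ∑ x, X x := by
    rw [← sum_add_distrib]
    exact sum_congr rfl fun x _ => by rw [hvx x]; simp only [X]; ring
  have hv2 : 16 * ∑ x, v x ^ 2 ≤ ∑ x, X x := by rw [mul_sum]; exact sum_le_sum fun x _ => hXv x
  -- the character machinery (as in `to18_typeO_E896_false`)
  obtain ⟨c₁, b₁, hcb⟩ := stub_affineForm (6 + 6) _ hd1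
  have hsb : signOf b₁ = 1 ∨ signOf b₁ = -1 := by cases b₁ <;> simp [signOf]
  set cE : (Fin (6 + 6) → Bool) → Bool := fun x => (decide (Odd (u x / 2)) ^^ decide (Odd (u x / 2 / 2))) ^^ true with hcEdef
  have hcE3 : IsDegLeFun 3 cE := hdegE
  have hcEcard : #(univ.filter fun x => cE x = true) = #E := by rw [hsetE]
  have hcEiff : ∀ x, cE x = true ↔ (Odd (u x / 2) ↔ Odd (u x / 2 / 2)) := by
    intro x; simp only [cE]; by_cases h1 : Odd (u x / 2) <;> by_cases h2 : Odd (u x / 2 / 2) <;> simp [h1, h2]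
  have hτ₀R : ∀ x, (τ₀ x : ℝ) = signOf b₁ * twist c₁ x * (1 - 4 * (if cE x = true then 1 else 0)) := by
    intro x
    simp only [τ₀]
    push_cast
    rw [tp_sZ_cast, hcb x]
    by_cases h : (Odd (u x / 2) ↔ Odd (u x / 2 / 2))
    · rw [if_pos h, if_pos ((hcEiff x).2 h)]
    · rw [if_neg h, if_neg (fun h' => h ((hcEiff x).1 h'))]
  obtain ⟨uf, huf⟩ := tw_base (n := 6 + 6) f hf 4 (by norm_num)
  have hinvg : ∀ y, ∑ x, (u x : ℝ) * twist x y = 256 * signOf (g y) := by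
    intro y
    have h := tz_inversion (fun y => signOf (g y)) y
    rw [sum_congr rfl fun x _ => by rw [hu x]] at h
    have h' : (2 : ℝ) ^ 4 * ∑ x, (u x : ℝ) * twist x y = 2 ^ (6 + 6) * signOf (g y) := by
      rw [mul_sum]; rw [← h]; exact sum_congr rfl fun x _ => by ring
    have e16 : (2 : ℝ) ^ (6 + 6) = 2 ^ 4 * 256 := by norm_num
    rw [e16, mul_assoc] at h'
    exact mul_left_cancel₀ (by positivity) h'
  have hWv : ∀ y, W (fun x => (v x : ℝ)) y = ∑ x, (v x : ℝ) * twist x y := fun y => rfl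
  have h64 : ∀ y, 64 * (uf y : ℝ) = 256 * signOf (g y) - ∑ x, (τ₀ x : ℝ) * twist x y - 8 * W (fun x => (v x : ℝ)) y := by
    intro y
    have hW4 : 4 * W (fun x => signOf (f x)) y = ∑ x, 4 * (signOf (f x) * twist x y) := by unfold W; rw [mul_sum]
    have e64 : 64 * (uf y : ℝ) = 4 * W (fun x => signOf (f x)) y := by rw [huf y]; ring
    rw [e64, hW4, hWv y, mul_sum, ← hinvg y, ← sum_sub_distrib, ← sum_sub_distrib]
    refine sum_congr rfl fun x _ => ?_
    have h := hvx x
    have h' : ((u x : ℤ) : ℝ) - 4 * (sZ (f x) : ℝ) = (τ₀ x : ℝ) + 8 * (v x : ℝ) := by exact_mod_cast h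
    rw [tp_sZ_cast] at h'
    have : (4 : ℝ) * signOf (f x) = (u x : ℝ) - (τ₀ x : ℝ) - 8 * (v x : ℝ) := by linarith
    rw [show (4 : ℝ) * (signOf (f x) * twist x y) = (4 * signOf (f x)) * twist x y by ring, this]; ring
  have hτ₀sum : ∀ y, ∑ x, (τ₀ x : ℝ) * twist x y =
      signOf b₁ * ((if bxor c₁ y = (fun _ => false) then (2 : ℝ) ^ (6 + 6) else 0) -
        4 * ∑ x ∈ univ.filter (fun x => cE x = true), twist x (bxor c₁ y)) := by
    intro y
    have e1 : ∀ x, (τ₀ x : ℝ) * twist x y = signOf b₁ * twist x (bxor c₁ y) -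
        signOf b₁ * (4 * (if cE x = true then twist x (bxor c₁ y) else 0)) := by
      intro x
      rw [hτ₀R x, twist_bxor_right, twist_comm x c₁]; split_ifs <;> ring
    rw [sum_congr rfl fun x _ => e1 x, sum_sub_distrib, ← mul_sum, ← mul_sum, ← mul_sum, tz_sum_twist_left, ← sum_filter]
    ring
  have hParsv : ∑ y, W (fun x => (v x : ℝ)) y ^ 2 = 4096 * ∑ x, ((v x : ℝ)) ^ 2 := by
    rw [sum_W_sq]; norm_num
  have hK : ∀ y, ∃ K : ℤ, W (fun x => (v x : ℝ)) y = 8 * (K : ℝ) + 4 * signOf b₁ := by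
    intro y
    obtain ⟨m, hm⟩ := to18_char_sum_mod16 cE hcE3 (bxor c₁ y)
    rw [hcEcard, hEq] at hm
    push_cast at hm
    have h := h64 y
    rw [hτ₀sum y, hm] at h
    have hsg : signOf (g y) = 1 ∨ signOf (g y) = -1 := by cases g y <;> simp [signOf]
    by_cases h0 : bxor c₁ y = (fun _ => false)
    · rw [if_pos h0] at h
      rcases hsb with hs | hs <;> rw [hs] at h ⊢ <;> rcases hsg with hg' | hg' <;> rw [hg'] at h <;> norm_num at h ⊢
      · exact ⟨4 - 64 + (q : ℤ) - m - uf y, by push_cast; linarith⟩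
      · exact ⟨-4 - 64 + (q : ℤ) - m - uf y, by push_cast; linarith⟩
      · exact ⟨4 + 64 - (q : ℤ) + m - uf y, by push_cast; linarith⟩
      · exact ⟨-4 + 64 - (q : ℤ) + m - uf y, by push_cast; linarith⟩
    · rw [if_neg h0] at h
      rcases hsb with hs | hs <;> rw [hs] at h ⊢ <;> rcases hsg with hg' | hg' <;> rw [hg'] at h <;> norm_num at h ⊢
      · exact ⟨4 + (q : ℤ) - m - uf y, by push_cast; linarith⟩
      · exact ⟨-4 + (q : ℤ) - m - uf y, by push_cast; linarith⟩
      · exact ⟨4 - (q : ℤ) + m - uf y, by push_cast; linarith⟩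
      · exact ⟨-4 - (q : ℤ) + m - uf y, by push_cast; linarith⟩
  have h16 : ∀ y, 16 ≤ W (fun x => (v x : ℝ)) y ^ 2 := by
    intro y
    obtain ⟨K, hK⟩ := hK y
    rw [hK]
    rcases hsb with hs | hs <;> rw [hs]
    · have : (8 * (K : ℝ) + 4 * 1) ^ 2 = 16 * (2 * (K : ℝ) + 1) ^ 2 := by ring
      rw [this]
      have h1 : (1 : ℝ) ≤ (2 * (K : ℝ) + 1) ^ 2 := by
        have hK' : (2 * K + 1 ≤ -1) ∨ (1 ≤ 2 * K + 1) := by omega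
        have := tp_sq_ge (k := 1) (by norm_num) hK'
        exact_mod_cast this
      linarith
    · have : (8 * (K : ℝ) + 4 * -1) ^ 2 = 16 * (2 * (K : ℝ) - 1) ^ 2 := by ring
      rw [this]
      have h1 : (1 : ℝ) ≤ (2 * (K : ℝ) - 1) ^ 2 := by
        have hK' : (2 * K - 1 ≤ -1) ∨ (1 ≤ 2 * K - 1) := by omega
        have := tp_sq_ge (k := 1) (by norm_num) hK'
        exact_mod_cast this
      linarith
  have hsum16 : (16 : ℝ) * 4096 ≤ ∑ y, W (fun x => (v x : ℝ)) y ^ 2 := by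
    have h := sum_le_sum fun y (_ : y ∈ (univ : Finset (Fin (6 + 6) → Bool))) => h16 y
    rw [sum_const, card_univ, Fintype.card_fun, Fintype.card_bool, Fintype.card_fin] at h
    norm_num at h ⊢
    linarith
  rw [hParsv] at hsum16
  have hv16 : (16 : ℝ) ≤ ∑ x, ((v x : ℝ)) ^ 2 := by linarith
  have hv16' : (16 : ℤ) ≤ ∑ x, v x ^ 2 := by exact_mod_cast hv16
  have hX256 : (256 : ℤ) ≤ ∑ x, X x := by linarith
  have hXR : (256 : ℝ) ≤ ((∑ x, X x : ℤ) : ℝ) := by exact_mod_cast hX256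
  have hdecR : ((∑ x, (u x - 4 * sZ (f x)) ^ 2 : ℤ) : ℝ) = ((∑ x, τ₀ x ^ 2 : ℤ) : ℝ) + ((∑ x, X x : ℤ) : ℝ) := by exact_mod_cast hTdec
  have hτR : ((∑ x, τ₀ x ^ 2 : ℤ) : ℝ) = 4096 + 8 * (#E : ℝ) := by exact_mod_cast hsumτ₀
  rw [← hbud, hdecR, hτR]
  linarith

end Summit.QuantumAdvantage.QuantumAdvantage.Theorems.CubicForrelation.NearExactIsExact

end
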